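import Literature.RingTheory.CohomologyAnnihilator.NoetherDifferent
import Mathlib.Algebra.Polynomial.Identities
import Mathlib.FieldTheory.PrimitiveElement
import Mathlib.FieldTheory.Minpoly.IsIntegrallyClosed
import Mathlib.RingTheory.Localization.Integral
import Mathlib.RingTheory.Localization.Finiteness
import Mathlib.RingTheory.Algebraic.Integral
import HarnessLib

/-!
# The noether different of a generically separable finite extension is non-zero (Iyengar–Takahashi, Lemma 3.5)

Topic: `Literature/RingTheory/CohomologyAnnihilator`. [IyengarTakahashi2014, Lemma 3.5 and the
sentence following it]: for a module-finite extension `A ⊆ Λ` of domains the noether different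
`𝔑(Λ/A)` localises, `𝔑(Λ/A) ⊗_A K ≅ 𝔑((Λ ⊗_A K)/K)`, "thus when the `K`-algebra `Λ ⊗_A K` is
separable, the ideal `𝔑(Λ/A)` is non-zero" — the input of Theorem 3.6 from a SEPARABLE noether
normalisation. We PROVE the commutative case in the following explicit form (avoiding the
localisation of `𝔑`, by exhibiting an element):

* `mul_aeval_derivative_mem_noetherDifferent` — for ANY commutative algebra `P → B`, `θ ∈ B`, a
  polynomial `g ∈ P[X]` with `g(θ) = 0`, and `b₀ ∈ P` with `b₀ B ⊆ P[θ]`, the element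
  `b₀ · g'(θ)` lies in `𝔑(B/P)`: in `B ⊗_P B` with `x = θ ⊗ 1`, `y = 1 ⊗ θ`, Taylor expansion gives
  `0 = g(x) - g(y) = (g'(y) + k (x - y)) (x - y)`, so `t₀ = g'(y) + k (x - y)` kills `x - y`, hence
  kills `h(x) - h(y) = (h(θ) ⊗ 1) - (1 ⊗ h(θ))` for every `h ∈ P[X]`, hence `(b₀ ⊗ 1) t₀` kills all
  `b ⊗ 1 - 1 ⊗ b`; and `μ(t₀) = g'(θ)` (the classical computation `𝔑(P[X]/(g)) = (g')`).
* `noetherDifferent_ne_bot_of_isSeparable` — consequently, for a module-finite injective extension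
  of domains `P ⊆ B` with `P` integrally closed and `Frac B / Frac P` separable, `𝔑(B/P) ≠ 0`
  (primitive element `θ ∈ B`, `g` its minimal polynomial, which has coefficients in `P` and is
  separable, and a common denominator `b₀` of module generators of `B` in `Frac P [θ] = Frac B`).
  [cite: IyengarTakahashi2014, Lemma 3.5]

## References

* S. B. Iyengar, R. Takahashi, *Annihilation of cohomology and strong generation of module
  categories*, IMRN 2016; arXiv:1404.1476 — Lemma 3.5; M. Auslander, O. Goldman, *The Brauer
  group of a commutative ring*, Trans. AMS 97 (1960), Prop. 1.1 / 4.4. [`IyengarTakahashi2014`]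
-/

noncomputable section

open Polynomial
open scoped TensorProduct nonZeroDivisors

universe u

namespace Literature.RingTheory.CohomologyAnnihilator

/-! ## The explicit element `b₀ g'(θ) ∈ 𝔑(B/P)` -/

section Element

variable {P B : Type u} [CommRing P] [CommRing B] [Algebra P B]

/-- **`b₀ · g'(θ) ∈ 𝔑(B/P)`** whenever `g(θ) = 0` (`g ∈ P[X]`) and `b₀ B ⊆ P[θ]` (`b₀ ∈ P`); see the
module docstring for the proof via Taylor expansion in `B ⊗_P B`.
[cite: IyengarTakahashi2014, Lemma 3.5 (proof, commutative case)] -/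
theorem mul_aeval_derivative_mem_noetherDifferent (θ : B) {g : P[X]} (hg : aeval θ g = 0) {b₀ : P}
    (hb₀ : ∀ b : B, ∃ h : P[X], b₀ • b = aeval θ h) :
    algebraMap P B b₀ * aeval θ (derivative g) ∈ noetherDifferent P B := by
  let x : B ⊗[P] B := θ ⊗ₜ[P] (1 : B)
  let y : B ⊗[P] B := (1 : B) ⊗ₜ[P] θ
  have hx : ∀ h : P[X], aeval x h = (aeval θ h) ⊗ₜ[P] (1 : B) := fun h => by
    have : x = (Algebra.TensorProduct.includeLeft : B →ₐ[P] B ⊗[P] B) θ := rfl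
    rw [this, aeval_algHom_apply, Algebra.TensorProduct.includeLeft_apply]
  have hy : ∀ h : P[X], aeval y h = (1 : B) ⊗ₜ[P] (aeval θ h) := fun h => by
    have : y = (Algebra.TensorProduct.includeRight : B →ₐ[P] B ⊗[P] B) θ := rfl
    rw [this, aeval_algHom_apply, Algebra.TensorProduct.includeRight_apply]
  -- Taylor expansion of `g` at `y` with increment `x - y`
  obtain ⟨k, hk⟩ := (g.map (algebraMap P (B ⊗[P] B))).binomExpansion y (x - y)
  rw [add_sub_cancel, derivative_map, eval_map_algebraMap, eval_map_algebraMap,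
    eval_map_algebraMap, hx, hy, hg, TensorProduct.zero_tmul, TensorProduct.tmul_zero,
    zero_add] at hk
  set t₀ : B ⊗[P] B := aeval y (derivative g) + k * (x - y) with ht₀def
  have ht₀ : t₀ * (x - y) = 0 := by
    have : t₀ * (x - y) = aeval y (derivative g) * (x - y) + k * (x - y) ^ 2 := by
      rw [ht₀def]; ring
    rw [this]
    exact hk.symm
  -- `t₀` kills `h(θ) ⊗ 1 - 1 ⊗ h(θ)` for every `h ∈ P[X]`
  have hpoly : ∀ h : P[X],
      ((aeval θ h) ⊗ₜ[P] (1 : B) - (1 : B) ⊗ₜ[P] (aeval θ h)) * t₀ = 0 := fun h => by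
    obtain ⟨z, hz⟩ := (h.map (algebraMap P (B ⊗[P] B))).evalSubFactor x y
    rw [eval_map_algebraMap, eval_map_algebraMap, hx, hy] at hz
    rw [hz, mul_assoc, mul_comm (x - y) t₀, ht₀, mul_zero]
  refine ⟨(algebraMap P B b₀ ⊗ₜ[P] (1 : B)) * t₀, fun b => ?_, ?_⟩
  · obtain ⟨h, hh⟩ := hb₀ b
    have e1 : (b ⊗ₜ[P] (1 : B)) * (algebraMap P B b₀ ⊗ₜ[P] (1 : B)) = (b₀ • b) ⊗ₜ[P] (1 : B) := by
      rw [Algebra.TensorProduct.tmul_mul_tmul, one_mul, mul_comm b, ← Algebra.smul_def]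
    have e2 : ((1 : B) ⊗ₜ[P] b) * (algebraMap P B b₀ ⊗ₜ[P] (1 : B)) = (1 : B) ⊗ₜ[P] (b₀ • b) := by
      rw [Algebra.TensorProduct.tmul_mul_tmul, one_mul, mul_one, Algebra.algebraMap_eq_smul_one,
        TensorProduct.smul_tmul]
    rw [← mul_assoc, ← mul_assoc, e1, e2, hh]
    have := hpoly h
    rw [sub_mul, sub_eq_zero] at this
    exact this
  · have hμx : Algebra.TensorProduct.lmul' (S := B) P x = θ := by
      simp [x, Algebra.TensorProduct.lmul'_apply_tmul]
    have hμy : Algebra.TensorProduct.lmul' (S := B) P y = θ := by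
      simp [y, Algebra.TensorProduct.lmul'_apply_tmul]
    rw [map_mul, Algebra.TensorProduct.lmul'_apply_tmul, mul_one, ht₀def, map_add, map_mul,
      map_sub, hμx, hμy, sub_self, mul_zero, add_zero, ← aeval_algHom_apply, hμy]

/-- Hence `𝔑(B/P) ≠ 0` for a domain `B` as soon as such data exist with `b₀ ≠ 0` injected and
`g'(θ) ≠ 0`. [cite: IyengarTakahashi2014, Lemma 3.5] -/
theorem noetherDifferent_ne_bot_of_exists [IsDomain B] (hinj : Function.Injective (algebraMap P B))
    {θ : B} {g : P[X]} (hg : aeval θ g = 0) (hg' : aeval θ (derivative g) ≠ 0) {b₀ : P}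
    (hb₀0 : b₀ ≠ 0) (hb₀ : ∀ b : B, ∃ h : P[X], b₀ • b = aeval θ h) :
    noetherDifferent P B ≠ ⊥ := by
  have hmem := mul_aeval_derivative_mem_noetherDifferent θ hg hb₀
  intro hbot
  rw [hbot, Ideal.mem_bot] at hmem
  exact mul_ne_zero ((map_ne_zero_iff _ hinj).mpr hb₀0) hg' hmem

end Element

/-! ## From separability of the fraction fields -/

section Separable

variable (P : Type u) {B : Type u} [CommRing P] [IsDomain P] [CommRing B] [IsDomain B]
  [Algebra P B] [Module.Finite P B] [FaithfulSMul P B]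
  (F L : Type u) [Field F] [Field L] [Algebra P F] [IsFractionRing P F] [Algebra B L]
  [IsFractionRing B L] [Algebra P L] [IsScalarTower P B L] [Algebra F L] [IsScalarTower P F L]

/-- A finite separable extension of fraction fields `Frac B / Frac P` (`B` module-finite over `P`)
has a primitive element in `B`. [folklore] -/
theorem exists_primitive_element_mem [Algebra.IsSeparable F L] :
    ∃ θ : B, IntermediateField.adjoin F {algebraMap B L θ} = ⊤ ∧ IsIntegral P θ := by
  haveI : IsLocalization (Algebra.algebraMapSubmonoid B P⁰) L := inferInstance
  haveI : FiniteDimensional F L := Module.Finite.of_isLocalization P B P⁰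
  obtain ⟨α, hα⟩ := Field.exists_primitive_element F L
  obtain ⟨⟨b, s⟩, hbs⟩ := IsLocalization.surj (Algebra.algebraMapSubmonoid B P⁰) α
  obtain ⟨p, hp, hps⟩ := s.2
  refine ⟨b, ?_, Algebra.IsIntegral.isIntegral b⟩
  rw [eq_top_iff, ← hα, IntermediateField.adjoin_simple_le_iff]
  have hpL : algebraMap B L s = algebraMap F L (algebraMap P F p) := by
    rw [← hps, ← IsScalarTower.algebraMap_apply, ← IsScalarTower.algebraMap_apply]
  have hp0 : algebraMap F L (algebraMap P F p) ≠ 0 := by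
    rw [← IsScalarTower.algebraMap_apply, IsScalarTower.algebraMap_apply P B L]
    intro h
    exact nonZeroDivisors.ne_zero hp ((FaithfulSMul.algebraMap_injective P B)
      ((IsFractionRing.injective B L) (by rw [h, map_zero, map_zero])))
  have hα' : α = algebraMap B L b * (algebraMap F L (algebraMap P F p))⁻¹ := by
    rw [← hpL, ← hbs, mul_inv_cancel_right₀ (hpL ▸ hp0)]
  rw [hα']
  exact mul_mem (IntermediateField.mem_adjoin_simple_self F _)
    (inv_mem (IntermediateField.algebraMap_mem _ _))

omit [IsDomain B] [FaithfulSMul P B] in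
/-- If `Frac P ⟮θ⟯ = Frac B` for some `θ ∈ B`, then a non-zero `b₀ ∈ P` multiplies `B` into `P[θ]`
(clear the denominators of module generators of `B` written as `Frac P`-polynomials in `θ`).
[folklore] -/
theorem exists_smul_eq_aeval (θ : B) (hθ : IntermediateField.adjoin F {algebraMap B L θ} = ⊤) :
    ∃ b₀ : P, b₀ ≠ 0 ∧ ∀ b : B, ∃ h : P[X], b₀ • b = aeval θ h := by
  have hint : IsIntegral F (algebraMap B L θ) :=
    ((Algebra.IsIntegral.isIntegral (R := P) θ).algebraMap (B := L)).tower_top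
  -- one element at a time
  have hone : ∀ b : B, ∃ c : P, c ≠ 0 ∧ ∃ h : P[X], c • b = aeval θ h := by
    intro b
    have hbL : algebraMap B L b ∈ (IntermediateField.adjoin F {algebraMap B L θ}).toSubalgebra := by
      rw [hθ]; trivial
    rw [IntermediateField.adjoin_simple_toSubalgebra_of_isAlgebraic hint.isAlgebraic,
      Algebra.adjoin_singleton_eq_range_aeval] at hbL
    obtain ⟨q, hq⟩ := hbL
    have hq' : aeval (algebraMap B L θ) q = algebraMap B L b := hq
    obtain ⟨c, hc, hN⟩ := IsLocalization.integerNormalization_spec P⁰ q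
    refine ⟨c, nonZeroDivisors.ne_zero hc, IsLocalization.integerNormalization P⁰ q, ?_⟩
    apply IsFractionRing.injective B L
    have h1 : algebraMap B L (c • b) = algebraMap P L c * algebraMap B L b := by
      rw [Algebra.smul_def, map_mul, ← IsScalarTower.algebraMap_apply]
    have h2 : algebraMap B L (aeval θ (IsLocalization.integerNormalization P⁰ q)) =
        algebraMap P L c * algebraMap B L b := by
      rw [← aeval_algebraMap_apply, ← aeval_map_algebraMap F, hN, ← algebraMap_smul F c q,
        smul_eq_C_mul, map_mul, aeval_C, ← IsScalarTower.algebraMap_apply, hq']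
    rw [h1, h2]
  -- a common denominator for module generators of `B`
  classical
  obtain ⟨s, hs⟩ := Module.Finite.fg_top (R := P) (M := B)
  choose c hc0 h hh using hone
  refine ⟨∏ b ∈ s, c b, Finset.prod_ne_zero_iff.mpr fun b _ => hc0 b, fun b => ?_⟩
  let S : Submodule P B :=
    { carrier := {b | ∃ h' : P[X], (∏ b' ∈ s, c b') • b = aeval θ h'}
      zero_mem' := ⟨0, by simp⟩
      add_mem' := by
        rintro b₁ b₂ ⟨h₁, hh₁⟩ ⟨h₂, hh₂⟩
        exact ⟨h₁ + h₂, by rw [smul_add, hh₁, hh₂, map_add]⟩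
      smul_mem' := by
        rintro r b₁ ⟨h₁, hh₁⟩
        exact ⟨r • h₁, by rw [smul_comm, hh₁, map_smul]⟩ }
  have hsS : (s : Set B) ⊆ S := fun b' hb' =>
    ⟨(∏ b'' ∈ s.erase b', c b'') • h b', by
      rw [map_smul, ← hh b', ← mul_smul, Finset.prod_erase_mul s c (Finset.mem_coe.mp hb')]⟩
  have htop : (⊤ : Submodule P B) ≤ S := hs ▸ Submodule.span_le.mpr hsS
  exact htop (Submodule.mem_top : b ∈ ⊤)

/-- **Lemma 3.5 (commutative case): `𝔑(B/P) ≠ 0` for a module-finite extension of domains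
`P ⊆ B`, `P` integrally closed, with `Frac B / Frac P` separable.**
[cite: IyengarTakahashi2014, Lemma 3.5] -/
theorem noetherDifferent_ne_bot_of_isSeparable [IsIntegrallyClosed P] [Algebra.IsSeparable F L] :
    noetherDifferent P B ≠ ⊥ := by
  obtain ⟨θ, hθ, hint⟩ := exists_primitive_element_mem P (B := B) F L
  -- the minimal polynomial of `θ` over `P` is separable over `Frac P`
  have hmin : minpoly F (algebraMap B L θ) = (minpoly P θ).map (algebraMap P F) :=
    minpoly.isIntegrallyClosed_eq_field_fractions F L hint
  have hder : aeval (algebraMap B L θ) (derivative (minpoly F (algebraMap B L θ))) ≠ 0 :=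
    (Algebra.IsSeparable.isSeparable F _).aeval_derivative_ne_zero (minpoly.aeval F _)
  rw [hmin, derivative_map, aeval_map_algebraMap, aeval_algebraMap_apply] at hder
  have hder' : aeval θ (derivative (minpoly P θ)) ≠ 0 := fun h => hder (by rw [h, map_zero])
  obtain ⟨b₀, hb₀0, hb₀⟩ := exists_smul_eq_aeval P F L θ hθ
  exact noetherDifferent_ne_bot_of_exists (FaithfulSMul.algebraMap_injective P B)
    (minpoly.aeval P θ) hder' hb₀0 hb₀

end Separable

end Literature.RingTheory.CohomologyAnnihilator

end
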